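import Summits.QuantumFields.YangMills.Theorems.VirialFluxGapRegularityCutoff
import Summits.QuantumFields.YangMills.Theorems.VirialFluxGapGenericPiece
import HarnessLib

/-!
# Route `VirialFluxGap` (YangMills): SMOOTH SIGN SELECTORS for the central charts — globally smooth functions of the coordinates that equal the
# toron signs `σ_B ∈ {±1}` (with `½ ≤ σ_B·Re q`) on the central region and are LOCALLY CONSTANT there

Toward ⟨stmt-QuantumFields-24141⟩ `VirialFluxGap.PeriodicSoftness`.  The central-chart theorems of the w3 lineage (✓`ringDeficit_centralProj_le_mul`,
✓`exists_fixChart_centralProj`, `centralProj σ σ₄`, the explicit central field of memo `w3-g59-EXPLICIT-CENTRAL-FIELD-24141.md`) carry SIGN hypotheses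
`σ_k, σ₄ ∈ {±1}`, `½ ≤ σ_k·Re su2Quat(wrapReps (P.1 0) k)`, `½ ≤ σ₄·Re su2Quat(P.2 0)`: the 16 central torons.  The assembler (fcl-p3 g41) wants ONE global
smooth central coefficient family without a case split.  This file supplies the selectors, in the letters of ✓`VirialFluxGapRegularityCutoff`:

* §1 def `signStep r := 1 − 2·ψ(2r + 1)` (fcl-p3's smooth step ✓`deficitStep`): smooth, `= −1` on `r ≤ −¼`, `= +1` on `r ≥ 0`, values in `[−1,1]`;
* §2 defs `linkSign k M := signStep(Re tr(M.1 0 (wrapEdge k))/2)`, `seamSign M := signStep(Re tr(M.2 0)/2)` — smooth (`contDiff_linkSign ∕ _seamSign`); on a ring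
  history the argument is `Re su2Quat` of the slice-0 wrap link ∕ seam root (`linkSign_ringCoord`), on an `X_fix` point that of ✓`wrapReps` (`linkSign_fixEmbed`,
  via ✓`treeFix_glue`);
* §3 ★ ON THE CENTRAL REGION (`(Re q)² ≥ ¼`, i.e. mass `≤ ¾`, which every `ρ`-central point with `ρ² ≤ ¾` satisfies): `linkSign ∈ {1, −1}`
  (`linkSign_eq_one_of_re_nonneg`, `linkSign_eq_neg_one_of_re_le`), ★ `half_le_linkSign_mul_re` (`½ ≤ linkSign·Re q` — the sign hypothesis, discharged),
  `linkSign_sq_eq_one`, and the same for the seam;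
* §4 ★ LOCAL CONSTANCY: `linkSign_eventuallyEq_of_re_ge_half` ∕ `_of_re_le_neg_half` (`linkSign =ᶠ[𝓝 M] ±1` on the open sets `{Re tr/2 > 0}` ⊇ `{Re q ≥ ½}`,
  `{Re tr/2 < −¼}` ⊇ `{Re q ≤ −½}`), hence ★ `frameD_linkSign_eq_zero` ∕ `frameD_seamSign_eq_zero` at such points (✓`FieldPatching.frameD_eq_zero_of_eventuallyEq`):
  in the divergence bookkeeping the selectors behave as the constants `σ`.

HONEST FRAMING: plumbing (three problem-side data definitions `signStep`, `linkSign`, `seamSign`; no `Prop`); the central field, its inequalities and the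
assembly are NOT here; ⟨24141⟩ and ⟨22884⟩ stay OPEN; no stub ∕ crux ∕ rung ∕ summit is closed; the Yang–Mills mass gap is NOT proved; no summit is proved by
a line.  0 `sorry`, standard axioms.  Width seat `ym-line-sfw-p2-w2` g52 (cell ym-idea-1, free hands), `--supports stmt-QuantumFields-24141`.
References: [cite: Luscher1983, §2] (the 16 central torons); [folklore].
-/

set_option autoImplicit false

noncomputable section

open scoped Matrix BigOperators ContDiff Topology Quaternion
open MeasureTheory
open Literature.MathematicalPhysics.QuantumFieldTheory hiding SU2
open Literature.MathematicalPhysics.QuantumLattice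
open Literature.MathematicalPhysics.QuantumFieldTheory.SUNBakryEmery (expSU coe_expSU matTop)

namespace Summit.QuantumFields.YangMills.Theorems.VirialFluxGap.RegCutoff

open Summit.QuantumFields.YangMills.Theorems.FemtoTransferGap
open Summit.QuantumFields.YangMills.Theorems.FemtoTransferGap.TT
open Summit.QuantumFields.YangMills.Theorems.FemtoTransferGap.TwoLattice
open Summit.QuantumFields.YangMills.Theorems.FemtoTransferGap.TwoLattice.Flat
open Summit.QuantumFields.YangMills.Theorems.VirialFluxGap.RingDeficit
open Summit.QuantumFields.YangMills.Theorems.VirialFluxGap.FrameDerivative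
open Summit.QuantumFields.YangMills.Theorems.VirialFluxGap.FrameHessian
open Summit.QuantumFields.YangMills.Theorems.VirialFluxGap.FieldPatching (frameD_eq_zero_of_eventuallyEq)

variable {L : ℕ} [NeZero L]

open scoped Matrix.Norms.Frobenius

attribute [local instance 2000] Literature.MathematicalPhysics.QuantumFieldTheory.SUNBakryEmery.matTop

/-! ## §1 The smooth sign step -/

/-- The smooth SIGN STEP `s(r) = 1 − 2ψ(2r + 1)`: `−1` for `r ≤ −¼`, `+1` for `r ≥ 0`. [folklore] -/
def signStep (r : ℝ) : ℝ := 1 - 2 * deficitStep (2 * r + 1)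

omit [NeZero L] in
/-- The sign step is smooth. [folklore] -/
theorem contDiff_signStep : ContDiff ℝ ∞ signStep :=
  contDiff_const.sub (contDiff_const.mul (contDiff_deficitStep.comp ((contDiff_const.mul contDiff_id).add contDiff_const)))

omit [NeZero L] in
/-- `s = 1` on `[0, ∞)`. [folklore] -/
theorem signStep_eq_one {r : ℝ} (hr : 0 ≤ r) : signStep r = 1 := by
  unfold signStep
  rw [deficitStep_eq_zero (by linarith)]
  ring

omit [NeZero L] in
/-- `s = −1` on `(−∞, −¼]`. [folklore] -/
theorem signStep_eq_neg_one {r : ℝ} (hr : r ≤ -(1 / 4)) : signStep r = -1 := by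
  unfold signStep
  rw [deficitStep_eq_one (by linarith)]
  ring

omit [NeZero L] in
/-- `−1 ≤ s ≤ 1`. [folklore] -/
theorem signStep_mem {r : ℝ} : -1 ≤ signStep r ∧ signStep r ≤ 1 := by
  unfold signStep
  have h0 := deficitStep_nonneg (2 * r + 1)
  have h1 := deficitStep_le_one (2 * r + 1)
  constructor <;> linarith

/-! ## §2 The selectors as functions of the coordinates -/

/-- The SIGN SELECTOR of the slice-0 wrap link `k`: `signStep(Re tr(M.1 0 (wrapEdge k))/2)`. [cite: Luscher1983, §2] -/
def linkSign (k : Fin 3) (M : (Fin (2 * L - 1 + 1) → Edge 3 L → Matrix (Fin 2) (Fin 2) ℂ) × (Site 3 L → Matrix (Fin 2) (Fin 2) ℂ)) : ℝ :=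
  signStep (((M.1 0 (wrapEdge k)).trace).re / 2)

/-- The SIGN SELECTOR of the seam root: `signStep(Re tr(M.2 0)/2)`. [cite: Luscher1983, §2] -/
def seamSign (M : (Fin (2 * L - 1 + 1) → Edge 3 L → Matrix (Fin 2) (Fin 2) ℂ) × (Site 3 L → Matrix (Fin 2) (Fin 2) ℂ)) : ℝ :=
  signStep (((M.2 0).trace).re / 2)

/-- The link selectors are smooth. [folklore] -/
theorem contDiff_linkSign (k : Fin 3) : ContDiff ℝ ∞ (linkSign (L := L) k) := by
  unfold linkSign
  exact contDiff_signStep.comp ((contDiff_reTr.comp (contDiff_coord_fst 0 (wrapEdge k))).div_const 2)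

/-- The seam selector is smooth. [folklore] -/
theorem contDiff_seamSign : ContDiff ℝ ∞ (seamSign (L := L)) := by
  unfold seamSign
  exact contDiff_signStep.comp ((contDiff_reTr.comp (contDiff_coord_snd 0)).div_const 2)

/-- On a ring history the link selector reads `Re su2Quat` of the raw slice-0 wrap link. [folklore] -/
theorem linkSign_ringCoord (k : Fin 3) (P : (Fin (2 * L - 1 + 1) → GaugeConfig 3 L SU2) × (Site 3 L → SU2)) :
    linkSign k (ringCoord L P) = signStep (su2Quat (P.1 0 (wrapEdge k))).re := by
  unfold linkSign ringCoord
  dsimp only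
  rw [su2_trace_re_eq_quat]
  congr 1
  ring

/-- On a ring history the seam selector reads `Re su2Quat (P.2 0)`. [folklore] -/
theorem seamSign_ringCoord (P : (Fin (2 * L - 1 + 1) → GaugeConfig 3 L SU2) × (Site 3 L → SU2)) :
    seamSign (ringCoord L P) = signStep (su2Quat (P.2 0)).re := by
  unfold seamSign ringCoord
  dsimp only
  rw [su2_trace_re_eq_quat]
  congr 1
  ring

/-- On an `X_fix` point the link selector reads `Re su2Quat` of the wrap representative of ✓`regular_or_central`. [folklore] -/
theorem linkSign_fixEmbed (k : Fin 3) (x : (OffIdx L → SU2) × ((Fin (2 * L - 1) → GaugeConfig 3 L SU2) × (Site 3 L → SU2))) :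
    linkSign k (ringCoord L ((Fin.cons (glue x.1) x.2.1 : Fin (2 * L - 1 + 1) → GaugeConfig 3 L SU2), x.2.2)) =
      signStep (su2Quat (wrapReps ((Fin.cons (glue x.1) x.2.1 : Fin (2 * L - 1 + 1) → GaugeConfig 3 L SU2) 0) k)).re := by
  rw [linkSign_ringCoord, wrapReps_eq]
  have h0 : (Fin.cons (glue x.1) x.2.1 : Fin (2 * L - 1 + 1) → GaugeConfig 3 L SU2) 0 = glue x.1 := Fin.cons_zero _ _
  show signStep (su2Quat ((Fin.cons (glue x.1) x.2.1 : Fin (2 * L - 1 + 1) → GaugeConfig 3 L SU2) 0 (wrapEdge k))).re =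
    signStep (su2Quat (treeFix ((Fin.cons (glue x.1) x.2.1 : Fin (2 * L - 1 + 1) → GaugeConfig 3 L SU2) 0) (wrapEdge k))).re
  rw [h0, treeFix_glue]

/-! ## §3 Values on the central region: the sign hypotheses discharged -/

omit [NeZero L] in
/-- `s(r) = 1` and `½ ≤ s(r)·r` for `r ≥ ½`. [folklore] -/
theorem signStep_of_ge_half {r : ℝ} (hr : 1 / 2 ≤ r) : signStep r = 1 ∧ 1 / 2 ≤ signStep r * r := by
  rw [signStep_eq_one (by linarith)]
  exact ⟨rfl, by linarith⟩

omit [NeZero L] in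
/-- `s(r) = −1` and `½ ≤ s(r)·r` for `r ≤ −½`. [folklore] -/
theorem signStep_of_le_neg_half {r : ℝ} (hr : r ≤ -(1 / 2)) : signStep r = -1 ∧ 1 / 2 ≤ signStep r * r := by
  rw [signStep_eq_neg_one (by linarith)]
  exact ⟨rfl, by linarith⟩

omit [NeZero L] in
/-- ★ **On the central region the sign step selects the toron sign**: if `r² ≥ ¼` (i.e. the mass `1 − r² ≤ ¾`) then `s(r) = 1 ∨ s(r) = −1`, `s(r)² = 1`
and `½ ≤ s(r)·r` — the sign hypotheses of the central-chart theorems. [cite: Luscher1983, §2] -/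
theorem signStep_central {r : ℝ} (hr : 1 / 4 ≤ r ^ 2) : (signStep r = 1 ∨ signStep r = -1) ∧ signStep r ^ 2 = 1 ∧ 1 / 2 ≤ signStep r * r := by
  by_cases h : 0 ≤ r
  · have hr' : 1 / 2 ≤ r := by nlinarith
    obtain ⟨h1, h2⟩ := signStep_of_ge_half hr'
    exact ⟨Or.inl h1, by rw [h1]; norm_num, h2⟩
  · have hr' : r ≤ -(1 / 2) := by nlinarith
    obtain ⟨h1, h2⟩ := signStep_of_le_neg_half hr'
    exact ⟨Or.inr h1, by rw [h1]; norm_num, h2⟩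

/-- ★ **The link selector on the central region of a ring history**: if `1 − Re²(su2Quat (P.1 0 (wrapEdge k))) ≤ ¾` then
`linkSign k = ±1`, `linkSign² = 1` and `½ ≤ linkSign·Re su2Quat`. [cite: Luscher1983, §2] -/
theorem linkSign_central (k : Fin 3) (P : (Fin (2 * L - 1 + 1) → GaugeConfig 3 L SU2) × (Site 3 L → SU2))
    (h : 1 - (su2Quat (P.1 0 (wrapEdge k))).re ^ 2 ≤ 3 / 4) :
    (linkSign k (ringCoord L P) = 1 ∨ linkSign k (ringCoord L P) = -1) ∧ linkSign k (ringCoord L P) ^ 2 = 1 ∧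
      1 / 2 ≤ linkSign k (ringCoord L P) * (su2Quat (P.1 0 (wrapEdge k))).re := by
  rw [linkSign_ringCoord]
  exact signStep_central (by linarith)

/-- ★ The seam selector on the central region of a ring history. [cite: Luscher1983, §2] -/
theorem seamSign_central (P : (Fin (2 * L - 1 + 1) → GaugeConfig 3 L SU2) × (Site 3 L → SU2)) (h : 1 - (su2Quat (P.2 0)).re ^ 2 ≤ 3 / 4) :
    (seamSign (ringCoord L P) = 1 ∨ seamSign (ringCoord L P) = -1) ∧ seamSign (ringCoord L P) ^ 2 = 1 ∧
      1 / 2 ≤ seamSign (ringCoord L P) * (su2Quat (P.2 0)).re := by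
  rw [seamSign_ringCoord]
  exact signStep_central (by linarith)

/-- The link selector in terms of the link mass: central iff `linkMass k ≤ ¾`. [folklore] -/
theorem linkSign_central_of_linkMass (k : Fin 3) (P : (Fin (2 * L - 1 + 1) → GaugeConfig 3 L SU2) × (Site 3 L → SU2))
    (h : linkMass k (ringCoord L P) ≤ 3 / 4) :
    (linkSign k (ringCoord L P) = 1 ∨ linkSign k (ringCoord L P) = -1) ∧ linkSign k (ringCoord L P) ^ 2 = 1 ∧
      1 / 2 ≤ linkSign k (ringCoord L P) * (su2Quat (P.1 0 (wrapEdge k))).re :=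
  linkSign_central k P (by rwa [linkMass_ringCoord] at h)

/-- The seam selector in terms of the seam mass. [folklore] -/
theorem seamSign_central_of_seamMass (P : (Fin (2 * L - 1 + 1) → GaugeConfig 3 L SU2) × (Site 3 L → SU2)) (h : seamMass (ringCoord L P) ≤ 3 / 4) :
    (seamSign (ringCoord L P) = 1 ∨ seamSign (ringCoord L P) = -1) ∧ seamSign (ringCoord L P) ^ 2 = 1 ∧
      1 / 2 ≤ seamSign (ringCoord L P) * (su2Quat (P.2 0)).re :=
  seamSign_central P (by rwa [seamMass_ringCoord] at h)

/-! ## §4 Local constancy on the central region: the selectors have zero frame derivatives there -/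

omit [NeZero L] in
/-- The sign step is locally `1` near every `r > 0` and locally `−1` near every `r < −¼`. [folklore] -/
theorem signStep_eventuallyEq {r : ℝ} (hr : 0 < r ∨ r < -(1 / 4)) : ∃ a : ℝ, signStep =ᶠ[𝓝 r] fun _ => a := by
  rcases hr with hr | hr
  · exact ⟨1, Filter.eventuallyEq_of_mem (Ioi_mem_nhds hr) fun y hy => signStep_eq_one (le_of_lt hy)⟩
  · exact ⟨-1, Filter.eventuallyEq_of_mem (Iio_mem_nhds hr) fun y hy => signStep_eq_neg_one (le_of_lt hy)⟩

omit [NeZero L] in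
/-- A selector `signStep ∘ f` with `f` continuous is locally constant near every point where `f > 0` or `f < −¼`. [folklore] -/
theorem signStep_comp_eventuallyEq {f : ((Fin (2 * L - 1 + 1) → Edge 3 L → Matrix (Fin 2) (Fin 2) ℂ) × (Site 3 L → Matrix (Fin 2) (Fin 2) ℂ)) → ℝ}
    (hf : Continuous f) {M : (Fin (2 * L - 1 + 1) → Edge 3 L → Matrix (Fin 2) (Fin 2) ℂ) × (Site 3 L → Matrix (Fin 2) (Fin 2) ℂ)}
    (hM : 0 < f M ∨ f M < -(1 / 4)) : ∃ a : ℝ, (fun M' => signStep (f M')) =ᶠ[𝓝 M] fun _ => a := by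
  obtain ⟨a, ha⟩ := signStep_eventuallyEq hM
  exact ⟨a, (hf.continuousAt.tendsto.eventually ha).mono fun M' h => h⟩

/-- ★ **The link selector has zero frame derivative on the central region** (`(Re tr/2)² ≥ ¼` at the wrap link): it is locally constant there. [folklore] -/
theorem frameD_linkSign_eq_zero (k : Fin 3) {M : (Fin (2 * L - 1 + 1) → Edge 3 L → Matrix (Fin 2) (Fin 2) ℂ) × (Site 3 L → Matrix (Fin 2) (Fin 2) ℂ)}
    (hM : 1 / 4 ≤ ((((M.1 0 (wrapEdge k)).trace).re / 2) ^ 2)) (Y : ((Fin (2 * L - 1 + 1) × Edge 3 L) ⊕ Site 3 L) → Matrix (Fin 2) (Fin 2) ℂ) :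
    frameD Y (linkSign k) M = 0 := by
  have hf : Continuous fun M' : ((Fin (2 * L - 1 + 1) → Edge 3 L → Matrix (Fin 2) (Fin 2) ℂ) × (Site 3 L → Matrix (Fin 2) (Fin 2) ℂ)) =>
      ((M'.1 0 (wrapEdge k)).trace).re / 2 := ((contDiff_reTr.comp (contDiff_coord_fst 0 (wrapEdge k))).div_const 2).continuous
  have hM' : 0 < ((M.1 0 (wrapEdge k)).trace).re / 2 ∨ ((M.1 0 (wrapEdge k)).trace).re / 2 < -(1 / 4) := by
    by_cases h : 0 ≤ ((M.1 0 (wrapEdge k)).trace).re / 2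
    · left; nlinarith
    · right; nlinarith
  obtain ⟨a, ha⟩ := signStep_comp_eventuallyEq hf hM'
  exact frameD_eq_zero_of_eventuallyEq (a := a) ha Y

/-- ★ **The seam selector has zero frame derivative on the central region.** [folklore] -/
theorem frameD_seamSign_eq_zero {M : (Fin (2 * L - 1 + 1) → Edge 3 L → Matrix (Fin 2) (Fin 2) ℂ) × (Site 3 L → Matrix (Fin 2) (Fin 2) ℂ)}
    (hM : 1 / 4 ≤ ((((M.2 0).trace).re / 2) ^ 2)) (Y : ((Fin (2 * L - 1 + 1) × Edge 3 L) ⊕ Site 3 L) → Matrix (Fin 2) (Fin 2) ℂ) :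
    frameD Y seamSign M = 0 := by
  have hf : Continuous fun M' : ((Fin (2 * L - 1 + 1) → Edge 3 L → Matrix (Fin 2) (Fin 2) ℂ) × (Site 3 L → Matrix (Fin 2) (Fin 2) ℂ)) =>
      ((M'.2 0).trace).re / 2 := ((contDiff_reTr.comp (contDiff_coord_snd 0)).div_const 2).continuous
  have hM' : 0 < ((M.2 0).trace).re / 2 ∨ ((M.2 0).trace).re / 2 < -(1 / 4) := by
    by_cases h : 0 ≤ ((M.2 0).trace).re / 2
    · left; nlinarith
    · right; nlinarith
  obtain ⟨a, ha⟩ := signStep_comp_eventuallyEq hf hM'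
  exact frameD_eq_zero_of_eventuallyEq (a := a) ha Y

/-- ★ On a ring history: if the link mass is `≤ ¾` (every `ρ`-central point with `ρ² ≤ ¾`), the link selector has zero frame derivatives. [folklore] -/
theorem frameD_linkSign_ringCoord_eq_zero (k : Fin 3) (P : (Fin (2 * L - 1 + 1) → GaugeConfig 3 L SU2) × (Site 3 L → SU2))
    (h : linkMass k (ringCoord L P) ≤ 3 / 4) (Y : ((Fin (2 * L - 1 + 1) × Edge 3 L) ⊕ Site 3 L) → Matrix (Fin 2) (Fin 2) ℂ) :
    frameD Y (linkSign k) (ringCoord L P) = 0 := by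
  refine frameD_linkSign_eq_zero k ?_ Y
  unfold linkMass at h
  linarith

/-- ★ On a ring history: if the seam mass is `≤ ¾`, the seam selector has zero frame derivatives. [folklore] -/
theorem frameD_seamSign_ringCoord_eq_zero (P : (Fin (2 * L - 1 + 1) → GaugeConfig 3 L SU2) × (Site 3 L → SU2))
    (h : seamMass (ringCoord L P) ≤ 3 / 4) (Y : ((Fin (2 * L - 1 + 1) × Edge 3 L) ⊕ Site 3 L) → Matrix (Fin 2) (Fin 2) ℂ) :
    frameD Y seamSign (ringCoord L P) = 0 := by
  refine frameD_seamSign_eq_zero ?_ Y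
  unfold seamMass at h
  linarith

end Summit.QuantumFields.YangMills.Theorems.VirialFluxGap.RegCutoff

end
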